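import Literature.AlgebraicGeometry.Deformation.SmoothLiftAtlasRefinementQuot
import Literature.AlgebraicGeometry.Deformation.SmoothLiftObstructionClassAtlasQuot
import Literature.AlgebraicGeometry.Morphisms.CechModuleH2RefinementInjective
import HarnessLib

/-!
# Refinement of a lifted atlas, II: the refined κ-cochain represents the restricted face readings; the refined class
# (Hartshorne, *Deformation Theory*, proof of Thm. 10.2 (a), Cor. 10.3 (a); [Oort1971] §2.2; [GortzWedhorn2023] (21.16))

Layer `Literature/AlgebraicGeometry/Deformation`, namespace `Literature.AlgebraicGeometry.Deformation.AtlasRefinementQuot` (continued).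
PROOF FILE, THEOREMS ONLY (no definition, no instance, no notation, no named fact, no `sorry`).  Sequel head (vii-e) «ATLAS REFINEMENT», second
half (cell `hodgecm-mathlib`, P6 sub-desk P6b; count-neutral ★ capital on `--supports stmt-HodgeConjecture-24832`): the κ-side closed-fibre layer of
★ (vii-b) `SmoothLiftObstructionClassAtlasQuot` (`B W := Γ(X, i⁻¹ W)` for the closed fibre `X : Over (Spec κ)` over `X₀` by `i`, `π`, `hπ`, `hπnat`)
and the Čech refinement currency ★ `Morphisms/CechModuleH2Refinement{,Lemmas,Injective}` (`cechMRefineC2`), over the first half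
`SmoothLiftAtlasRefinementQuot` (`exists_faceReadings_refine`).

THE PRINT.  [Hartshorne2010, Thm. 10.2 (a), proof, p. 81 and Cor. 10.3 (a), p. 82]: «just one obstruction in `H²(X₀, 𝒯_{X₀} ⊗ J)`» — in
particular the class does not depend on the covering (our words).  [GortzWedhorn2023, (21.16) Def. 21.71]: the refinement map
`ρ_τ` on Čech cochains; [Lemma 22.1, Thm. 22.9]: on an affine cover `Ȟ²(𝒰) → Ȟ²(𝒱)` is injective for a refinement `𝒱`.

* `isAffineOpen_preimage_refine` — the refined trace cover `j ↦ i⁻¹ V′ j` of the closed fibre is affine (letter `hiV′`).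
* **`refineC2_rep`** (e2) — if `o ∈ Č²(i⁻¹𝒰; 𝒯_{X/κ})` represents readings `δ_{abd}` (`ho`) and `δ′_{jkl}` are their restrictions to the new triples
  (naturality squares), then `ρ_τ o = cechMRefineC2 … τ _ o` represents `δ′` (★ (vii) `tangentSheaf_section_rep_restrict`).
* `cechMH2_mk_refine_eq_zero` (e3) — `[o] = 0 ⇒ [ρ_τ o] = 0`; `cechMH2_mk_eq_zero_of_refine` — conversely for the AFFINE trace cover, `𝒯_{X/κ}`
  affine-localizing (hypothesis) and `V′` a cover (★ `CechMH2.mk_eq_zero_of_refineMC2_mem_cechMB2_of_isAffineOpen`).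
* **`exists_faceReadings_refine_rep`** — THE CONSUMER'S HEAD (e1 + e2 on the κ-side): the restricted atlas has face readings `δ′` with
  `readingAut′ δ′ = disc′`, represented by `ρ_τ o`; together with the first half's letters these are all the letters of ★ (D)
  `AbelianLiftObstructionClass` for the restricted datum (consumer (vii-g) instantiates `i := pr₁` of the canonical closed fibre).

HC_CM is proved only modulo the printed citations until rung 0 closes; nothing here bears on a summit statement.

## References
* [Hartshorne2010] R. Hartshorne, *Deformation Theory*, GTM 257, Springer (2010): Thm. 10.2 (a) and its proof (p. 81), Cor. 10.3 (a) (p. 82),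
  Remark 10.2.2 (p. 82) (automorphisms over the identity ≅ `H⁰(T⁰ ⊗ J)`).
* [Oort1971] F. Oort, *Finite group schemes, local moduli for abelian varieties, and lifting problems*, Compositio Math. 23 (1971), §2.2
  (pp. 277–280).
* [GortzWedhorn2023] U. Görtz, T. Wedhorn, *Algebraic Geometry II: Cohomology of Schemes*, Springer (2023): (21.16) Def. 21.71 (p. 181),
  Lemma 22.1 (p. 233), Thm. 22.9 (p. 236).
* [Hartshorne1977] R. Hartshorne, *Algebraic Geometry*, GTM 52 (1977): III §4 p. 218 (Čech cochains on an affine cover), III Thm. 4.5 (p. 222).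
-/

noncomputable section

-- `TopCat.Presheaf`/`TopCat.Sheaf` are not reducible (as in Mathlib's `AlgebraicGeometry/Modules`).
set_option backward.isDefEq.respectTransparency false

open CategoryTheory AlgebraicGeometry Opposite TopologicalSpace
open scoped TensorProduct

universe u

namespace Literature.AlgebraicGeometry.Deformation.AtlasRefinementQuot

open Literature.AlgebraicGeometry.HodgeTheory Literature.AlgebraicGeometry.Modules
  Literature.AlgebraicGeometry.Motives Literature.AlgebraicGeometry.Morphisms
  Literature.AlgebraicGeometry.Deformation.LiftObstructionCechClassQuot Literature.AlgebraicGeometry.Deformation.LiftObstructionClassAtlasQuot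
  Literature.AlgebraicGeometry.Deformation.AtlasQuot Literature.AlgebraicGeometry.Deformation.CanonicalLiftQuot
  Literature.AlgebraicGeometry.Deformation.ExtensionAutomorphisms Literature.AlgebraicGeometry.Deformation.ExtensionAutomorphismsQuot
  Literature.AlgebraicGeometry.Deformation.LiftObstructionCocycleQuot Literature.AlgebraicGeometry.Deformation.LiftCocycleExactnessQuot

section Kappa

variable {A' : Type u} [CommRing A'] {κ : Type u} [Field κ] [Algebra A' κ] (hκ : Function.Surjective (algebraMap A' κ))
  {X : Over (Spec (CommRingCat.of κ))} [instΓ : ∀ W : X.left.Opens, Algebra A' Γ(X.left, W)]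
  (halg : ∀ (W : X.left.Opens) (a : A'), algebraMap A' Γ(X.left, W) a = (constToPresheaf X).app (op W) (algebraMap A' κ a))
  (J : Ideal A') (φ : ↥J ≃ₗ[A'] κ)
  {X₀ : Scheme.{u}} (i : X.left ⟶ X₀) {ι : Type u} (V : ι → X₀.affineOpens) (c : (a b : ι) → Γ(X₀, (V a).1))
  (hc : ∀ a b, (V a).1 ⊓ (V b).1 = X₀.basicOpen (c a b)) (hiV : ∀ a, IsAffineOpen (i ⁻¹ᵁ (V a).1))
  {ι' : Type u} (V' : ι' → X₀.affineOpens) (τ : ι' → ι) (hτ : ∀ j, (V' j).1 ≤ (V (τ j)).1)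
  (pτ : ∀ j, ∃ q : Γ(X₀, (V (τ j)).1), (V' j).1 = X₀.basicOpen q)
  (c' : (j k : ι') → Γ(X₀, (V' j).1)) (hc' : ∀ j k, (V' j).1 ⊓ (V' k).1 = X₀.basicOpen (c' j k))

omit [Algebra A' κ] instΓ in
include hiV pτ in
/-- The refined trace cover of the closed fibre is affine (letter `hiV′`): `i⁻¹ D(q) = D(i^♯ q)` in the affine `i⁻¹ V (τ j)`.
[cite: Hartshorne1977, III §4 p. 218] -/
theorem isAffineOpen_preimage_refine (j : ι') : IsAffineOpen (i ⁻¹ᵁ (V' j).1) := by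
  obtain ⟨q, hq⟩ := pτ j
  rw [hq, Scheme.preimage_basicOpen]
  exact (hiV (τ j)).basicOpen _

include hκ halg hc hiV pτ hc' in
/-- **THE REFINED COCHAIN REPRESENTS THE RESTRICTED FACE READINGS** (e2): if `o ∈ Č²(i⁻¹𝒰; 𝒯_{X/κ})` represents readings `δ_{abd}` on the old
triples and `δ′_{jkl}` are their restrictions to the new triples (naturality squares along the sheaf restriction — e.g. the face readings of the
restricted atlas, `exists_faceReadings_refine`), then the REFINED cochain `ρ_τ o = cechMRefineC2 … τ o` represents `δ′` (★ (vii)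
`tangentSheaf_section_rep_restrict`). [cite: Hartshorne2010, Thm. 10.2 (a) (proof), p. 81] [cite: GortzWedhorn2023, (21.16) Def. 21.71 (p. 181)] -/
theorem refineC2_rep
    {δ : (a b d : ι) → Derivation A' Γ(X.left, i ⁻¹ᵁ ((V a).1 ⊓ (V b).1 ⊓ (V d).1)) (Γ(X.left, i ⁻¹ᵁ ((V a).1 ⊓ (V b).1 ⊓ (V d).1)) ⊗[A'] ↥J)}
    {o : CechMC2 X.hom (tangentSheaf X) (fun a => i ⁻¹ᵁ (V a).1)}
    (ho : ∀ (a b d : ι) (x : Γ(X.left, i ⁻¹ᵁ (V a).1 ⊓ i ⁻¹ᵁ (V b).1 ⊓ i ⁻¹ᵁ (V d).1)),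
      δ a b d x = (show Γ(X.left, i ⁻¹ᵁ (V a).1 ⊓ i ⁻¹ᵁ (V b).1 ⊓ i ⁻¹ᵁ (V d).1) from
        appLE (o a b d) (𝟙 _) (dSection X _ x)) ⊗ₜ φ.symm 1)
    {δ' : (j k l : ι') → Derivation A' Γ(X.left, i ⁻¹ᵁ ((V' j).1 ⊓ (V' k).1 ⊓ (V' l).1))
      (Γ(X.left, i ⁻¹ᵁ ((V' j).1 ⊓ (V' k).1 ⊓ (V' l).1)) ⊗[A'] ↥J)}
    (g : (j k l : ι') → Γ(X.left, i ⁻¹ᵁ ((V (τ j)).1 ⊓ (V (τ k)).1 ⊓ (V (τ l)).1)) →ₐ[A']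
      Γ(X.left, i ⁻¹ᵁ ((V' j).1 ⊓ (V' k).1 ⊓ (V' l).1)))
    (hg : ∀ j k l x, g j k l x = X.left.presheaf.map (homOfLE (i.preimage_mono (inf_le_inf (inf_le_inf (hτ j) (hτ k)) (hτ l)))).op x)
    (hδ' : ∀ j k l x, δ' j k l (g j k l x) = LinearMap.rTensor ↥J (g j k l).toLinearMap (δ (τ j) (τ k) (τ l) x)) :
    ∀ (j k l : ι') (x : Γ(X.left, i ⁻¹ᵁ (V' j).1 ⊓ i ⁻¹ᵁ (V' k).1 ⊓ i ⁻¹ᵁ (V' l).1)),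
      δ' j k l x = (show Γ(X.left, i ⁻¹ᵁ (V' j).1 ⊓ i ⁻¹ᵁ (V' k).1 ⊓ i ⁻¹ᵁ (V' l).1) from
        appLE (cechMRefineC2 X.hom (tangentSheaf X) (fun a => i ⁻¹ᵁ (V a).1) (fun j => i ⁻¹ᵁ (V' j).1) τ
          (fun j => i.preimage_mono (hτ j)) o j k l) (𝟙 _) (dSection X _ x)) ⊗ₜ φ.symm 1 := by
  intro j k l x
  have hiV' := isAffineOpen_preimage_refine i V hiV V' τ pτ
  exact LiftObstructionCechClassQuot.tangentSheaf_section_rep_restrict hκ halg J φ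
    (isAffineOpen_inf₃ (fun a => (⟨i ⁻¹ᵁ (V a).1, hiV a⟩ : X.left.affineOpens)) (fun a b => i.app (V a).1 (c a b))
      (preimage_inf_eq_basicOpen (X := X) V c hc i hiV) (τ j) (τ k) (τ l))
    (isAffineOpen_inf₃ (fun j => (⟨i ⁻¹ᵁ (V' j).1, hiV' j⟩ : X.left.affineOpens)) (fun j k => i.app (V' j).1 (c' j k))
      (preimage_inf_eq_basicOpen (X := X) V' c' hc' i hiV') j k l)
    (inf_le_inf (inf_le_inf (i.preimage_mono (hτ j)) (i.preimage_mono (hτ k))) (i.preimage_mono (hτ l)))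
    (ho (τ j) (τ k) (τ l)) (hg j k l) (hδ' j k l) x

omit [Algebra A' κ] instΓ in
/-- **Class zero passes to the refinement** (e3, easy direction): `[o] = 0 ⇒ [ρ_τ o] = 0` (★ `refineMC2_mem_cechMB2`).
[cite: GortzWedhorn2023, (21.16) Def. 21.71 (p. 181)] -/
theorem cechMH2_mk_refine_eq_zero {o : CechMC2 X.hom (tangentSheaf X) (fun a => i ⁻¹ᵁ (V a).1)}
    (ho₂ : o ∈ cechMZ2 X.hom (tangentSheaf X) (fun a => i ⁻¹ᵁ (V a).1))
    (h0 : CechMH2.mk X.hom (tangentSheaf X) (fun a => i ⁻¹ᵁ (V a).1) ⟨o, ho₂⟩ = 0) :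
    CechMH2.mk X.hom (tangentSheaf X) (fun j => i ⁻¹ᵁ (V' j).1)
        ⟨cechMRefineC2 X.hom (tangentSheaf X) (fun a => i ⁻¹ᵁ (V a).1) (fun j => i ⁻¹ᵁ (V' j).1) τ (fun j => i.preimage_mono (hτ j)) o,
          refineMC2_mem_cechMZ2 X.hom (tangentSheaf X) (fun a => i ⁻¹ᵁ (V a).1) (fun j => i ⁻¹ᵁ (V' j).1) τ _ ho₂⟩ = 0 := by
  rw [CechMH2.mk_eq_zero_iff] at h0 ⊢
  exact refineMC2_mem_cechMB2 X.hom (tangentSheaf X) _ _ τ _ h0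

omit [Algebra A' κ] instΓ in
include hiV in
/-- **… and back** (e3, injectivity of refinement on `Ȟ²` for the AFFINE trace cover `i⁻¹𝒰` and `𝒯_{X/κ}` affine-localizing, `V′` a cover):
`[ρ_τ o] = 0 ⇒ [o] = 0` (★ `CechMH2.mk_eq_zero_of_refineMC2_mem_cechMB2_of_isAffineOpen`). [cite: GortzWedhorn2023, Lemma 22.1 (p. 233) and Thm. 22.9 (p. 236)]
[cite: Hartshorne1977, III Thm. 4.5 (p. 222)] -/
theorem cechMH2_mk_eq_zero_of_refine (hT : IsAffineLocalizing (tangentSheaf X)) (hV' : ⨆ j, (V' j).1 = ⊤)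
    {o : CechMC2 X.hom (tangentSheaf X) (fun a => i ⁻¹ᵁ (V a).1)}
    (ho₂ : o ∈ cechMZ2 X.hom (tangentSheaf X) (fun a => i ⁻¹ᵁ (V a).1))
    (h0 : CechMH2.mk X.hom (tangentSheaf X) (fun j => i ⁻¹ᵁ (V' j).1)
        ⟨cechMRefineC2 X.hom (tangentSheaf X) (fun a => i ⁻¹ᵁ (V a).1) (fun j => i ⁻¹ᵁ (V' j).1) τ (fun j => i.preimage_mono (hτ j)) o,
          refineMC2_mem_cechMZ2 X.hom (tangentSheaf X) (fun a => i ⁻¹ᵁ (V a).1) (fun j => i ⁻¹ᵁ (V' j).1) τ _ ho₂⟩ = 0) :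
    CechMH2.mk X.hom (tangentSheaf X) (fun a => i ⁻¹ᵁ (V a).1) ⟨o, ho₂⟩ = 0 := by
  have hU : ∀ a, i ⁻¹ᵁ (V a).1 ≤ ⨆ j, i ⁻¹ᵁ (V' j).1 := fun a => by
    rw [← Scheme.Hom.preimage_iSup, hV']
    exact i.preimage_mono le_top
  rw [CechMH2.mk_eq_zero_iff] at h0
  exact CechMH2.mk_eq_zero_of_refineMC2_mem_cechMB2_of_isAffineOpen X.hom (tangentSheaf X) (fun a => i ⁻¹ᵁ (V a).1)
    (fun j => i ⁻¹ᵁ (V' j).1) τ (fun j => i.preimage_mono (hτ j)) hT hiV hU ⟨o, ho₂⟩ h0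

include hκ halg hc hiV pτ hc' in
/-- **THE CONSUMER'S HEAD (κ-side, e1 + e2): the restricted atlas has face readings, and the refined cochain represents them.**  In the
κ-side closed-fibre layer of ★ (vii-b) (`B W := Γ(X, i⁻¹ W)`, `π` with `hπ`, `hπnat`; e.g. the canonical closed fibre `X₀ ×_{A'⧸J} κ` with
`i := pr₁`, `π := pr₁^♯`), if `δ_{abd}` read the atlas' discrepancies and `o ∈ Č²(i⁻¹𝒰; 𝒯_{X/κ})` represents them (`ho`), then the restricted atlas
on the principal refinement `(V′, τ)` has face readings `δ′_{jkl}` (`readingAut′ δ′ = disc′`) represented by `ρ_τ o = cechMRefineC2 … τ _ o`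
(`ho′`) — `exists_faceReadings_refine` at the κ-side restriction maps (★ `exists_algHom_res`) + `refineC2_rep`.  With ★
`refineMC2_mem_cechMZ2` (`ho₂′`), `isAffineOpen_preimage_refine` (`hiV′`), `hπ_refine`, `refineRed_surjective`, `ker_refineRed`,
`reduction_refineGluing`, `flat_refineChart`, `isStandardSmooth_refineChart` these are ALL the letters of ★ (D) for the restricted datum.
[cite: Hartshorne2010, Thm. 10.2 (a) (proof) and Remark 10.2.2, pp. 81–82] [cite: Oort1971, §2.2 (pp. 277–279)]
[cite: GortzWedhorn2023, (21.16) Def. 21.71 (p. 181)] -/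
theorem exists_faceReadings_refine_rep [∀ W : X₀.Opens, Algebra A' Γ(X₀, W)]
    (halg₀ : ∀ (W W' : X₀.Opens) (e : W' ≤ W) (a : A'), X₀.presheaf.map (homOfLE e).op (algebraMap A' Γ(X₀, W) a) = algebraMap A' Γ(X₀, W') a)
    (hJ : IsNilpotent J) {P : ι → Type u} [∀ a, CommRing (P a)] [∀ a, Algebra A' (P a)] [∀ a, Module.Flat A' (P a)]
    (r : (a : ι) → P a →ₐ[A'] Γ(X₀, (V a).1)) (hr : ∀ a, Function.Surjective (r a))
    (hkr : ∀ a, RingHom.ker (r a) = J.map (algebraMap A' (P a)))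
    (ψ : (a b : ι) → chartLift V r a (inf_le_left : (V a).1 ⊓ (V b).1 ≤ (V a).1) ≃ₐ[A']
      chartLift V r b (inf_le_right : (V a).1 ⊓ (V b).1 ≤ (V b).1))
    (hψ : ∀ a b x, reduction (r b) (AtlasQuot.res (inf_le_right : (V a).1 ⊓ (V b).1 ≤ (V b).1)) (halg₀ _ _ _) (ψ a b x) =
      reduction (r a) (AtlasQuot.res (inf_le_left : (V a).1 ⊓ (V b).1 ≤ (V a).1)) (halg₀ _ _ _) x)
    [∀ j, Module.Flat A' (chartLift V r (τ j) (hτ j))]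
    (𝔪 : Ideal A') (h𝔪J : 𝔪 * J = ⊥) (hJ𝔪 : J ≤ 𝔪)
    (π : (W : X₀.Opens) → Γ(X₀, W) →ₐ[A'] Γ(X.left, i ⁻¹ᵁ W))
    (hπ : ∀ (a : ι) (W : X₀.Opens), W ≤ (V a).1 → (∃ q : Γ(X₀, (V a).1), W = X₀.basicOpen q) →
      Function.Surjective (π W) ∧ RingHom.ker (π W) = 𝔪.map (algebraMap A' Γ(X₀, W)))
    (hπnat : ∀ ⦃W W' : X₀.Opens⦄ (h : W' ≤ W) (x : Γ(X₀, W)),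
      X.left.presheaf.map (homOfLE (i.preimage_mono h)).op (π W x) = π W' (AtlasQuot.res h x))
    (δ : (a b d : ι) → Derivation A' Γ(X.left, i ⁻¹ᵁ ((V a).1 ⊓ (V b).1 ⊓ (V d).1)) (Γ(X.left, i ⁻¹ᵁ ((V a).1 ⊓ (V b).1 ⊓ (V d).1)) ⊗[A'] ↥J))
    (hδ : ∀ a b d, readingAut halg₀ hJ V r hr hkr 𝔪 π hπ h𝔪J hJ𝔪 a (inf_le_left.trans inf_le_left : (V a).1 ⊓ (V b).1 ⊓ (V d).1 ≤ (V a).1) ⟨_, inf₃_eq_basicOpen₁ V c hc a b d⟩ (δ a b d) = disc halg₀ hJ V c hc r hr hkr ψ hψ a b d)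
    {o : CechMC2 X.hom (tangentSheaf X) (fun a => i ⁻¹ᵁ (V a).1)}
    (ho : ∀ (a b d : ι) (x : Γ(X.left, i ⁻¹ᵁ (V a).1 ⊓ i ⁻¹ᵁ (V b).1 ⊓ i ⁻¹ᵁ (V d).1)),
      δ a b d x = (show Γ(X.left, i ⁻¹ᵁ (V a).1 ⊓ i ⁻¹ᵁ (V b).1 ⊓ i ⁻¹ᵁ (V d).1) from
        appLE (o a b d) (𝟙 _) (dSection X _ x)) ⊗ₜ φ.symm 1) :
    ∃ δ' : (j k l : ι') → Derivation A' Γ(X.left, i ⁻¹ᵁ ((V' j).1 ⊓ (V' k).1 ⊓ (V' l).1))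
        (Γ(X.left, i ⁻¹ᵁ ((V' j).1 ⊓ (V' k).1 ⊓ (V' l).1)) ⊗[A'] ↥J),
      (∀ j k l, readingAut halg₀ hJ V' (refineRed halg₀ V r V' τ hτ) (refineRed_surjective halg₀ hJ V r hr hkr V' τ hτ pτ)
          (ker_refineRed halg₀ hJ V r hr hkr V' τ hτ pτ) 𝔪 π (hπ_refine V V' τ hτ pτ 𝔪 π hπ) h𝔪J hJ𝔪 j
          (inf_le_left.trans inf_le_left : (V' j).1 ⊓ (V' k).1 ⊓ (V' l).1 ≤ (V' j).1) ⟨_, inf₃_eq_basicOpen₁ V' c' hc' j k l⟩ (δ' j k l) =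
        disc halg₀ hJ V' c' hc' (refineRed halg₀ V r V' τ hτ) (refineRed_surjective halg₀ hJ V r hr hkr V' τ hτ pτ)
          (ker_refineRed halg₀ hJ V r hr hkr V' τ hτ pτ) (refineGluing halg₀ hJ V r hr hkr ψ hψ V' τ hτ pτ c' hc')
          (reduction_refineGluing halg₀ hJ V r hr hkr ψ hψ V' τ hτ pτ c' hc') j k l) ∧
      ∀ (j k l : ι') (x : Γ(X.left, i ⁻¹ᵁ (V' j).1 ⊓ i ⁻¹ᵁ (V' k).1 ⊓ i ⁻¹ᵁ (V' l).1)),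
        δ' j k l x = (show Γ(X.left, i ⁻¹ᵁ (V' j).1 ⊓ i ⁻¹ᵁ (V' k).1 ⊓ i ⁻¹ᵁ (V' l).1) from
          appLE (cechMRefineC2 X.hom (tangentSheaf X) (fun a => i ⁻¹ᵁ (V a).1) (fun j => i ⁻¹ᵁ (V' j).1) τ
            (fun j => i.preimage_mono (hτ j)) o j k l) (𝟙 _) (dSection X _ x)) ⊗ₜ φ.symm 1 := by
  -- the κ-side restriction maps as `A'`-algebra maps (★ `exists_algHom_res`), compatible with `π` by `hπnat`
  have hex := fun (W W' : X₀.Opens) (h : W' ≤ W) =>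
    LiftObstructionCechClassQuot.exists_algHom_res (X := X) halg (i.preimage_mono h)
  choose g hg' using hex
  have hg : ∀ ⦃W W' : X₀.Opens⦄ (h : W' ≤ W) (x : Γ(X₀, W)), g W W' h (π W x) = π W' (AtlasQuot.res h x) :=
    fun W W' h x => by rw [hg', hπnat]
  obtain ⟨δ', hδ', hnat⟩ := exists_faceReadings_refine halg₀ hJ V c hc r hr hkr ψ hψ V' τ hτ pτ c' hc' 𝔪 h𝔪J hJ𝔪 π hπ
    (fun W W' h => g W W' h) hg δ hδ
  exact ⟨δ', hδ', refineC2_rep hκ halg J φ i V c hc hiV V' τ hτ pτ c' hc' ho (fun j k l => g _ _ _)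
    (fun j k l x => hg' _ _ _ x) hnat⟩

end Kappa

end Literature.AlgebraicGeometry.Deformation.AtlasRefinementQuot

end
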